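import Summits.QuantumFields.BalabanUV.Beta.D1BFx.NeedleNdlShape
import Summits.QuantumFields.BalabanUV.Beta.D1BFx.NeedleColumnLetters
import Summits.QuantumFields.BalabanUV.Beta.D1BFx.NeedleNdlProjLetters
import Summits.QuantumFields.BalabanUV.Beta.D1BFx.GluonNeedleGlue
import Summits.QuantumFields.BalabanUV.Beta.D1BFx.NeedleBondMarginal
import Summits.QuantumFields.BalabanUV.Beta.D1BFx.NeedleProjProjRow

/-!
# `BalabanUV.Beta.D1BFx.NeedleNdlProjRow` — road «BF-x» for binder row D1, slot (K), END row `hGrp gN`, «GN-33 ∕ NP»: THE `ndlPiece ⊗ projPiece` CELL OF THE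
# GLUON NEEDLE ROW T₃ IS n-UNIFORM — `|cellSum n a (ndlPiece n a (cQ n)) (projPiece n a) μ ν| ≤ C_NP` for every `n ≥ 1`, ONE `C_NP = C(a, cQ₀) ≥ 0`, modulo
# [B5, Prop. 1.2] ∧ [B5, (1.126)–(1.127)] BY NAME and a uniform bound `|cQ n| ≤ cQ₀` on the stencil weight (P13) — the hypothesis `hnp` of `GluonNeedleGlue.h₃_of_cells`
# (an3-g57 `N36-SPLIT.v1.md` §3′ (4) R1⊗R3: «every product `k·n^{λ′−6}` × `n^{6−λ′}` (R3 at the partner): n⁰», the census paid by the bond marginal M7)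

HONEST DEPENDENCY (cell records, verbatim): «continuum YM on T⁴ ⇐ BetaPertH ∧ nine spine estimates (0/9 proved); BetaPertH ⇐ (D1) ∧ (D4) ∧
CAP+tail; G-an2-4 gates asym, D1 and NE2/3/4.»  HONEST FRAMING (cell contract, verbatim): «discharging `BetaPertH` makes Bałaban's UV stability
UNCONDITIONAL — a real constructive-QFT result; it is NOT the continuum limit and NOT the Clay problem.»  THIS MODULE DISCHARGES NOTHING of the
wall: [folklore] lattice bookkeeping BY NAME over the owner's word shape `NeedleNdlShape.bubble_ndl_dJetSw` and column letters `NeedleColumnLetters.exists_applyK_gradC_le` ∕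
`exists_pairing_gradC_applyK_colGrad_le` ∕ `exists_pairing_applyK_gradC_rowGrad_le` ∕ `applyKT_eq_applyK_of_symm` (p264178), this seat's needle letters
`NeedleNdlProjLetters.exists_applyK_grad_row_le` ∕ `exists_pairing_grad_row_applyK_colGrad_le` ∕ `exists_pairing_applyK_grad_row_rowGrad_le`, gan24-leaf-05-g41's bond
marginal `NeedleBondMarginal.sum_bond_abs_qJet_le` (M7) and block-decay × mass junction `NeedleGhostBubble2Row.abs_fullSum_weight_le_of_blockDecay_mass`, leaf-04-g9's
`LatticeHLSProfiles.sum_pow_mul_exp_div_nrm_pow_free_scale_le`, the owner's `NeedleProjProjRow.sum_resSite_avg_le` ∕ `dist_blk_add_unitVec_le` and `GluonNeedleGlue.cellSum_def`.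
No `def`, no `def … : Prop`, nothing cited, 0 sorry; the printed statements are HYPOTHESES by name.  Root-level binders hW ∕ hR-sockets ∕ hSX-socket ∕ D1Tel ∕ D1Rep — 0
discharged; (K) NOT closed (T₃: 2∕9 cells with PP p261786; T₁∕T₂ 0∕6); NOT D1, NOT `BetaPertH`, NOT continuum, NOT Clay.

ABSOLUTE RULE (cell charter, verbatim): «No internally-minted statement may enter as a cited fact. Every hypothesis is either kernel-proved in
this package or a verbatim quotation of a PUBLISHED theorem with page reference. The manuscript(s) under audit are NOT citable for their own
disputed steps — they are the thing under adjudication; programme-internal (2001/route/tribunal) claims are never citable.»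

WHY (owner claim table «GN-CELLS» = `HOME/b2b-balaban-beta-d1-p2/GLUON-NEEDLE-ROWS.md` v0.2, cell NP; MINE journal 2026-08-21T11:09Z l.30690; RULING ρ-g10-7 l.30753 «GO AS STATED»).
With the needle at the PARTNER bond `u = (b+w, μ)` and the projector jet at the base `(b, ν)` the word is (`bubble_ndl_dJetSw`)
`[⟨∇ρ_u, Ga c′⟩·(Ga∇C_u)(b,ν) − (∇ρ_u Ga)(b,ν)·⟨Ga∇C_u, r′⟩] − [⟨∇C_u, Ga c′⟩·(Ga∇ρ_u)(b,ν) − (∇C_u Ga)(b,ν)·⟨Ga∇ρ_u, r′⟩]`; with the letters (column: `kN·C₀·n·e^{−δD}`,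
`kCP·C₀·e^{−δD}`, `kNP·C₀·e^{−δD}`; needle: `(k₅∕n⁴)·q_u`, `(kΦ∕n²)·Σ_s|qJet_u s|·e^{−(ε₀∕n)‖b−s‖}∕nrm(b−s)`, `(k₆∕n⁴)·q_u`, `q_u := Σ_{s∈B(blk u)}|qJet_u s|`) every product is
`e^{−δ·dist(blk b, blk u)} × Σ_s |qJet_u s|·(A·n⁻³ + B·n⁻²·e^{−(ε₀∕n)‖b−s‖}∕nrm(b−s))`; summing the PARTNER bond over a block first, the bond marginal
`Σ_{u∈B(β)} |qJet_u s| ≤ (n−1)·n⁻⁴` (M7) and `Σ_{s∈B(β)} e^{−(ε₀∕n)‖b−s‖}∕nrm(b−s) ≤ cR₁·n³` give the block mass `m₀ ≍ n⁻²`, which the weight `|w_μw_ν| ≲ n²(D+1)²` of the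
(1.22) sum spends exactly: n⁰ with NO cancellation, μ ≠ ν unused, the column's zero mass unused (an3 §3′ (5)∕(6)).

CONTENT (`a > 0`, `n ≥ 1`).
* §1 [folklore] **`abs_ndlProj_word_le`** — the pointwise bound from ABSTRACT letters (column letters with one block rate `δ`, needle letters with the needle weights inside):
  `|word(b,w)| ≤ ½e^{δ}·e^{−δ·dist(blk b, blk(b+w))}·Σ_{s∈B(blk(b+w))} |qJet_{b+w} s|·((K₅+K₆)·KGC + (K₃+K₄)·KΦ·e^{−ε‖b−s‖}∕nrm(b−s))`.
* §2 [folklore] `sum_B_prof_le` (`Σ_{s∈B β} e^{−(ε₀∕n)‖b−s‖}∕nrm(b−s) ≤ cR₁·n³`), **`sum_B_needle_mass_le`** (the census: `Σ_{u∈B β}Σ_{s∈B(blk u)}|qJet_u s|·g s ≤ ((n−1)n⁻⁴)·Σ_{s∈B β} g s`),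
  **`abs_fullSum_ndlProj_le`** — the (1.22) sum at one base site from abstract letters: `≤ (½e^{δ})·(n²·((1+4∕δ)²·(m₀·K₄(δ∕2))))`,
  `m₀ = ((n−1)n⁻⁴)·((K₅+K₆)·KGC·n⁴ + (K₃+K₄)·KΦ·cR₁·n³)`.
* §3 [folklore] **`exists_ndlProj_row_le`** — `∃ C ≥ 0, ∀ n [NeZero n], |cellSum n a (ndlPiece n a (cQ n)) (projPiece n a) μ ν| ≤ C` modulo `h12`∕`h126` and `hcQ : ∀ n, |cQ n| ≤ cQ₀`
  (letters instantiated: `KGC = kN·C₁·n`, `K₃ = kCP·C₁`, `K₄ = kNP·C₁`, `K₅ = k₅∕n⁴`, `K₆ = k₆∕n⁴`, `KΦ = kΦ∕n²`, `C₁ = cQ₀·cPPs + cPs`; `n²·m₀ = ((n−1)∕n)·Q ≤ Q`).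
NOT HERE (honest): the mirror cell PN (`hpn`; by the `b ↦ b+w, w ↦ −w` re-indexing of `cellSum` — owner's «CELLSUM-TRANSPOSE» — or by the R3-at-the-base count);
the other six cells of T₃; T₁∕T₂; the `h₃` glue (owner, `GluonNeedleGlue.h₃_of_cells`).
Unit `b2b-balaban-beta-d1-formalise-leaf-01` (gen 15), D1 formalisation swarm LEAF PROVER 01 on cross-road kernel duty; `LEAVES-BFx.md` row (N) «GN-33∕NP».
-/

noncomputable section

namespace Summit.QuantumFields.BalabanUV.Beta.D1BFx.NeedleNdlProjRow

open Finset
open scoped BigOperators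
open Literature.MathematicalPhysics.QuantumFieldTheory.Balaban1983to89
open Literature.MathematicalPhysics.QuantumFieldTheory.Balaban1983to89.Beta
open B4Sect5Proof (latticeConst latticeConst_nonneg)
open B6QGQLower276 (X e blk B mem_B)
open B6QGQDecay237 (card_B)
open ExpKernelCalculus (Site MKer Decays)
open DyadicShell (Pt toReal toReal_apply)
open Beta.PoissonInterior (nrm nrm_pos one_le_nrm nrm_neg)
open WindowIdentification (fullSum)
open DressedMomentNormalisation (resSite)
open AffineAveraging (unitVec)
open VectorTailsLoc (fam kfam)
open Summit.QuantumFields.BalabanUV.Beta.TameKernelCalculus (Spr)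
open Summit.QuantumFields.BalabanUV.Beta.D1BFx.PackedKernelSplit (bubble_eq_biBubble)
open Summit.QuantumFields.BalabanUV.Beta.D1BFx.FineHessianSectors (biBubbleTable biBubbleTable_apply)
open Summit.QuantumFields.BalabanUV.Beta.D1BFx.RProjector (Pgt kerP deltaPP deltaPP_pos)
open Summit.QuantumFields.BalabanUV.Beta.D1BFx.RJetProjector (decays_Pgt)
open Summit.QuantumFields.BalabanUV.Beta.D1BFx.ProjectorSupNorm (cPPs cPs cPPs_nonneg cPs_nonneg)
open Summit.QuantumFields.BalabanUV.Beta.D1BFx.GluonLeg (Ga)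
open Summit.QuantumFields.BalabanUV.Beta.D1BFx.GluonLegTails (spr_Ga_of_prop12)
open Summit.QuantumFields.BalabanUV.Beta.D1BFx.FrozenLegTails (nOf MOf hn1)
open Summit.QuantumFields.BalabanUV.Beta.D1BFx.GhostLeg (cast_pred_add_one)
open Summit.QuantumFields.BalabanUV.Beta.D1BFx.GhostStencil (qJet)
open Summit.QuantumFields.BalabanUV.Beta.D1BFx.GluonNeedleSplit (projPiece ndlPiece projPiece_apply)
open Summit.QuantumFields.BalabanUV.Beta.D1BFx.RankOneBubble (applyK applyKT pairing)
open Summit.QuantumFields.BalabanUV.Beta.D1BFx.RankOneBubbleJets (grad colGrad rowGrad)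
open Summit.QuantumFields.BalabanUV.Beta.D1BFx.NeedleProjLetters (exp_blocks_le)
open Summit.QuantumFields.BalabanUV.Beta.D1BFx.NeedlePotentialLetters (ndlRow)
open Summit.QuantumFields.BalabanUV.Beta.D1BFx.NeedleNdlShape (bubble_ndl_dJetSw)
open Summit.QuantumFields.BalabanUV.Beta.D1BFx.NeedleNdlProjLetters (exists_applyK_grad_row_le exists_pairing_grad_row_applyK_colGrad_le
  exists_pairing_applyK_grad_row_rowGrad_le)
open Summit.QuantumFields.BalabanUV.Beta.D1BFx.NeedleColumnLetters (applyKT_eq_applyK_of_symm exists_applyK_gradC_le exists_pairing_applyK_gradC_rowGrad_le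
  exists_pairing_gradC_applyK_colGrad_le)
open Summit.QuantumFields.BalabanUV.Beta.D1BFx.NeedleGhostBubble2Row (abs_fullSum_weight_le_of_blockDecay_mass)
open Summit.QuantumFields.BalabanUV.Beta.D1BFx.NeedleProjProjRow (dist_blk_add_unitVec_le sum_resSite_avg_le)
open Summit.QuantumFields.BalabanUV.Beta.D1BFx.GluonNeedleGlue (cellSum cellSum_def)

variable (n : ℕ) [NeZero n] (a : ℝ)

/-! ## §1 The pointwise bound of the `ndl ⊗ proj` word from abstract letters -/

/-- [folklore] **THE `ndl ⊗ proj` WORD, POINTWISE, FROM ABSTRACT LETTERS** (needle at the partner bond `u = (b+w, μ)`, projector jet at the base `(b, ν)`):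
with the column letters `KGC` (point), `K₃`, `K₄` (pairings) carrying block decay from `blk u` at ONE rate `δ`, the needle letters `KΦ` (damped degree-1 profile,
needle weights inside), `K₅`, `K₆` (needle weights inside):
`|word(b,w)| ≤ ½·e^{δ}·e^{−δ·dist(blk b, blk (b+w))}·Σ_{s∈B(blk(b+w))} |qJet_{b+w} s|·((K₅ + K₆)·KGC + (K₃ + K₄)·KΦ·e^{−ε‖b−s‖}∕nrm(b−s))`. -/
theorem abs_ndlProj_word_le (ha : 0 < a) (hA : Spr (Ga n a)) {cQ KGC KΦ K₃ K₄ K₅ K₆ δ ε : ℝ}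
    (hKGC : 0 ≤ KGC) (hKΦ : 0 ≤ KΦ) (hK₃ : 0 ≤ K₃) (hK₄ : 0 ≤ K₄) (hK₅ : 0 ≤ K₅) (hK₆ : 0 ≤ K₆) (hδ : 0 ≤ δ)
    (hGC : ∀ (u x : Pt) (α : Fin 4), |applyK (Ga n a)
        (grad (fun q => cQ * (∑ z ∈ B (n - 1) (blk (n - 1) u), Pgt n a z q () ()) - kerP (d := 4) (n - 1) a q (blk (n - 1) u))) x α|
      ≤ KGC * Real.exp (-(δ * dist (blk (n - 1) x) (blk (n - 1) u))))
    (hΦ : ∀ (κ : Fin 4) (u x : Pt) (α : Fin 4), |applyK (Ga n a) (grad (ndlRow n a κ u)) x α|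
      ≤ KΦ * ∑ s ∈ B (n - 1) (blk (n - 1) u), |qJet n κ u (blk (n - 1) u) s|
          * (Real.exp (-ε * PoissonInterior.supNorm (d := 4) (x - s)) / nrm (x - s) ^ 1))
    (h₃ : ∀ (u q : Pt), |pairing (grad (fun q' => cQ * (∑ z ∈ B (n - 1) (blk (n - 1) u), Pgt n a z q' () ()) - kerP (d := 4) (n - 1) a q' (blk (n - 1) u)))
        (applyK (Ga n a) (colGrad (Pgt n a) q))| ≤ K₃ * Real.exp (-(δ * dist (blk (n - 1) q) (blk (n - 1) u))))
    (h₄ : ∀ (u p : Pt), |pairing (applyK (Ga n a)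
        (grad (fun q' => cQ * (∑ z ∈ B (n - 1) (blk (n - 1) u), Pgt n a z q' () ()) - kerP (d := 4) (n - 1) a q' (blk (n - 1) u))))
        (rowGrad (Pgt n a) p)| ≤ K₄ * Real.exp (-(δ * dist (blk (n - 1) p) (blk (n - 1) u))))
    (h₅ : ∀ (κ : Fin 4) (u q : Pt), |pairing (grad (ndlRow n a κ u)) (applyK (Ga n a) (colGrad (Pgt n a) q))|
      ≤ K₅ * ∑ s ∈ B (n - 1) (blk (n - 1) u), |qJet n κ u (blk (n - 1) u) s|)
    (h₆ : ∀ (κ : Fin 4) (u p : Pt), |pairing (applyK (Ga n a) (grad (ndlRow n a κ u))) (rowGrad (Pgt n a) p)|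
      ≤ K₆ * ∑ s ∈ B (n - 1) (blk (n - 1) u), |qJet n κ u (blk (n - 1) u) s|)
    (μ ν : Fin 4) (b w : Pt) :
    |biBubbleTable (Ga n a) (Ga n a) (ndlPiece n a cQ) (projPiece n a) μ ν (b + w) b|
      ≤ (1 / 2) * Real.exp δ * Real.exp (-(δ * dist (blk (n - 1) b) (blk (n - 1) (b + w)))) *
          ∑ s ∈ B (n - 1) (blk (n - 1) (b + w)), |qJet n μ (b + w) (blk (n - 1) (b + w)) s| *
            ((K₅ + K₆) * KGC + (K₃ + K₄) * KΦ * (Real.exp (-ε * PoissonInterior.supNorm (d := 4) (b - s)) / nrm (b - s) ^ 1)) := by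
  have hn : (0 : ℝ) < n := by exact_mod_cast Nat.pos_of_ne_zero (NeZero.ne n)
  have hP : Spr (Pgt n a) := ⟨_, _, div_pos (deltaPP_pos 4 ha) (mul_pos (by norm_num) hn), decays_Pgt n a ha⟩
  set m : ℕ := n - 1 with hm
  set u : Pt := b + w with hu
  rw [biBubbleTable_apply, projPiece_apply, ← bubble_eq_biBubble, bubble_ndl_dJetSw ha hA hP ν b,
    applyKT_eq_applyK_of_symm a ha n, applyKT_eq_applyK_of_symm a ha n]
  -- the factors
  set Cf : Pt → ℝ := fun q => cQ * (∑ z ∈ B m (blk m u), Pgt n a z q () ()) - kerP (d := 4) m a q (blk m u) with hCf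
  set Wq : Pt → ℝ := fun s => |qJet n μ u (blk m u) s| with hWq
  set prof : Pt → ℝ := fun s => Real.exp (-ε * PoissonInterior.supNorm (d := 4) (b - s)) / nrm (b - s) ^ 1 with hprof
  set E : ℝ := Real.exp (-(δ * dist (blk m b) (blk m u))) with hE
  set F₁ := pairing (grad (ndlRow n a μ u)) (applyK (Ga n a) (colGrad (Pgt n a) (b + unitVec ν))) with hF₁
  set F₂ := applyK (Ga n a) (grad Cf) b ν with hF₂
  set F₃ := applyK (Ga n a) (grad (ndlRow n a μ u)) b ν with hF₃
  set F₄ := pairing (applyK (Ga n a) (grad Cf)) (rowGrad (Pgt n a) (b + unitVec ν)) with hF₄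
  set F₅ := pairing (grad Cf) (applyK (Ga n a) (colGrad (Pgt n a) (b + unitVec ν))) with hF₅
  set F₈ := pairing (applyK (Ga n a) (grad (ndlRow n a μ u))) (rowGrad (Pgt n a) (b + unitVec ν)) with hF₈
  have hE0 : 0 ≤ E := (Real.exp_pos _).le
  have hW0 : 0 ≤ ∑ s ∈ B m (blk m u), Wq s := Finset.sum_nonneg fun s _ => abs_nonneg _
  have hWP0 : 0 ≤ ∑ s ∈ B m (blk m u), Wq s * prof s :=
    Finset.sum_nonneg fun s _ => mul_nonneg (abs_nonneg _) (div_nonneg (Real.exp_pos _).le (pow_nonneg (nrm_pos _).le 1))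
  -- the shifted block of the projector bond `b + e_ν` costs `e^{δ}`
  have hshift : Real.exp (-(δ * dist (blk m (b + unitVec ν)) (blk m u))) ≤ Real.exp δ * E := by
    rw [hE, ← Real.exp_add, Real.exp_le_exp]
    have h1 : dist (blk m b) (blk m u) ≤ dist (blk m (b + unitVec ν)) (blk m u) + 1 := by
      have := dist_triangle (blk m b) (blk m (b + unitVec ν)) (blk m u)
      have h2 := dist_blk_add_unitVec_le n b ν
      rw [dist_comm] at h2
      linarith
    have h3 := mul_le_mul_of_nonneg_left h1 hδ
    rw [mul_add, mul_one] at h3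
    linarith
  have h1 : |F₁| ≤ K₅ * ∑ s ∈ B m (blk m u), Wq s := h₅ μ u (b + unitVec ν)
  have h2 : |F₂| ≤ KGC * E := hGC u b ν
  have h3 : |F₃| ≤ KΦ * ∑ s ∈ B m (blk m u), Wq s * prof s := hΦ μ u b ν
  have h4 : |F₄| ≤ K₄ * (Real.exp δ * E) := (h₄ u (b + unitVec ν)).trans (mul_le_mul_of_nonneg_left hshift hK₄)
  have h5 : |F₅| ≤ K₃ * (Real.exp δ * E) := (h₃ u (b + unitVec ν)).trans (mul_le_mul_of_nonneg_left hshift hK₃)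
  have h8 : |F₈| ≤ K₆ * ∑ s ∈ B m (blk m u), Wq s := h₆ μ u (b + unitVec ν)
  have e1 : |F₁ * F₂| ≤ (K₅ * ∑ s ∈ B m (blk m u), Wq s) * (KGC * E) := by
    rw [abs_mul]; exact mul_le_mul h1 h2 (abs_nonneg _) (mul_nonneg hK₅ hW0)
  have e2 : |F₃ * F₄| ≤ (KΦ * ∑ s ∈ B m (blk m u), Wq s * prof s) * (K₄ * (Real.exp δ * E)) := by
    rw [abs_mul]; exact mul_le_mul h3 h4 (abs_nonneg _) (mul_nonneg hKΦ hWP0)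
  have e3 : |F₅ * F₃| ≤ (K₃ * (Real.exp δ * E)) * (KΦ * ∑ s ∈ B m (blk m u), Wq s * prof s) := by
    rw [abs_mul]; exact mul_le_mul h5 h3 (abs_nonneg _) (by positivity)
  have e4 : |F₂ * F₈| ≤ (KGC * E) * (K₆ * ∑ s ∈ B m (blk m u), Wq s) := by
    rw [abs_mul]; exact mul_le_mul h2 h8 (abs_nonneg _) (by positivity)
  have hE1 : E ≤ Real.exp δ * E := le_mul_of_one_le_left hE0 (Real.one_le_exp hδ)
  calc |-(1 / 2 : ℝ) * (F₁ * F₂ - F₃ * F₄ - (F₅ * F₃ - F₂ * F₈))|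
      = (1 / 2) * |F₁ * F₂ - F₃ * F₄ - (F₅ * F₃ - F₂ * F₈)| := by
        rw [abs_mul, abs_neg, abs_of_pos (by norm_num : (0 : ℝ) < 1 / 2)]
    _ ≤ (1 / 2) * (|F₁ * F₂| + |F₃ * F₄| + (|F₅ * F₃| + |F₂ * F₈|)) := by
        refine mul_le_mul_of_nonneg_left ?_ (by norm_num)
        exact (abs_sub _ _).trans (add_le_add (abs_sub _ _) (abs_sub _ _))
    _ ≤ (1 / 2) * ((K₅ * ∑ s ∈ B m (blk m u), Wq s) * (KGC * E) + (KΦ * ∑ s ∈ B m (blk m u), Wq s * prof s) * (K₄ * (Real.exp δ * E))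
          + ((K₃ * (Real.exp δ * E)) * (KΦ * ∑ s ∈ B m (blk m u), Wq s * prof s) + (KGC * E) * (K₆ * ∑ s ∈ B m (blk m u), Wq s))) := by
        gcongr
    _ = (1 / 2) * (E * ((K₅ + K₆) * KGC * ∑ s ∈ B m (blk m u), Wq s)
          + Real.exp δ * E * ((K₃ + K₄) * KΦ * ∑ s ∈ B m (blk m u), Wq s * prof s)) := by ring
    _ ≤ (1 / 2) * (Real.exp δ * E * ((K₅ + K₆) * KGC * ∑ s ∈ B m (blk m u), Wq s)
          + Real.exp δ * E * ((K₃ + K₄) * KΦ * ∑ s ∈ B m (blk m u), Wq s * prof s)) := by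
        have hX : 0 ≤ (K₅ + K₆) * KGC * ∑ s ∈ B m (blk m u), Wq s := mul_nonneg (mul_nonneg (add_nonneg hK₅ hK₆) hKGC) hW0
        exact mul_le_mul_of_nonneg_left (add_le_add (mul_le_mul_of_nonneg_right hE1 hX) le_rfl) (by norm_num)
    _ = (1 / 2) * Real.exp δ * E * ∑ s ∈ B m (blk m u), Wq s * ((K₅ + K₆) * KGC + (K₃ + K₄) * KΦ * prof s) := by
        have hsplit : ∑ s ∈ B m (blk m u), Wq s * ((K₅ + K₆) * KGC + (K₃ + K₄) * KΦ * prof s)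
            = (K₅ + K₆) * KGC * ∑ s ∈ B m (blk m u), Wq s + (K₃ + K₄) * KΦ * ∑ s ∈ B m (blk m u), Wq s * prof s := by
          rw [Finset.mul_sum, Finset.mul_sum, ← Finset.sum_add_distrib]
          exact Finset.sum_congr rfl fun s _ => by ring
        rw [hsplit]; ring

/-! ## §2 The (1.22) sum at one base site: block decay × the bond-marginal mass -/

variable {n} in
/-- [folklore] the damped degree-one block sum at scale `n`: `Σ_{s ∈ B β} e^{−(ε₀∕n)‖b−s‖}∕nrm(b−s) ≤ cR₁(ε₀)·n³` (leaf-04-g9's damping-centre-free HLS sum, `p = 1`, `q = 0`). -/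
theorem sum_B_prof_le {ε₀ : ℝ} (hε₀ : 0 < ε₀) (b β : Pt) :
    ∑ s ∈ B (n - 1) β, Real.exp (-(ε₀ / n) * PoissonInterior.supNorm (d := 4) (b - s)) / nrm (b - s) ^ 1
      ≤ 2 * (Nat.factorial 0) * (2 / ε₀) ^ 0 * (1 + 2 * (4 : ℕ) * 3 ^ (4 - 1) * ((Nat.factorial (4 - 1 - 1)) * (4 / ε₀) ^ (4 - 1 - 1) * (1 + 4 / ε₀)))
        * (n : ℝ) ^ 3 := by
  have hn1 : 1 ≤ n := NeZero.one_le
  have h := LatticeHLSProfiles.sum_pow_mul_exp_div_nrm_pow_free_scale_le (d := 4) (by norm_num) hε₀ hn1 (p := 1) (by norm_num) 0 (B (n - 1) β) b b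
  simp only [pow_zero, one_mul] at h
  have e : ∀ s : Pt, Real.exp (-(ε₀ / n) * PoissonInterior.supNorm (d := 4) (b - s)) / nrm (b - s) ^ 1
      = Real.exp (-(ε₀ / n) * PoissonInterior.supNorm (d := 4) (s - b)) / nrm (s - b) ^ 1 := fun s => by
    rw [show b - s = -(s - b) by abel, PoissonInterior.supNorm_neg, nrm_neg]
  rw [Finset.sum_congr rfl fun s _ => e s]
  refine h.trans (le_of_eq ?_)
  rw [show (4 - 1 + 0 : ℕ) = 3 by norm_num]
  simp only [pow_zero, Nat.factorial]

variable {n} in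
/-- [folklore] **THE BOND-MARGINAL BLOCK MASS** (the census, M7 `NeedleBondMarginal.sum_bond_abs_qJet_le`): for `g ≥ 0`,
`Σ_{u ∈ B β} Σ_{s ∈ B(blk u)} |qJet_u s|·g s ≤ ((n−1)·n⁻⁴)·Σ_{s ∈ B β} g s` — every needle site is crossed by at most `n − 1` bonds of the block, each with weight `n⁻⁴`. -/
theorem sum_B_needle_mass_le (μ : Fin 4) (β : Pt) {g : Pt → ℝ} (hg : ∀ s, 0 ≤ g s) :
    ∑ u ∈ B (n - 1) β, ∑ s ∈ B (n - 1) (blk (n - 1) u), |qJet n μ u (blk (n - 1) u) s| * g s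
      ≤ (((n : ℝ) - 1) * ((n : ℝ) ^ 4)⁻¹) * ∑ s ∈ B (n - 1) β, g s := by
  calc ∑ u ∈ B (n - 1) β, ∑ s ∈ B (n - 1) (blk (n - 1) u), |qJet n μ u (blk (n - 1) u) s| * g s
      = ∑ u ∈ B (n - 1) β, ∑ s ∈ B (n - 1) β, |qJet n μ u β s| * g s := Finset.sum_congr rfl fun u hu => by rw [mem_B.1 hu]
    _ = ∑ s ∈ B (n - 1) β, (∑ u ∈ B (n - 1) β, |qJet n μ u β s|) * g s := by
        rw [Finset.sum_comm]; exact Finset.sum_congr rfl fun s _ => (Finset.sum_mul _ _ _).symm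
    _ ≤ ∑ s ∈ B (n - 1) β, (((n : ℝ) - 1) * ((n : ℝ) ^ 4)⁻¹) * g s :=
        Finset.sum_le_sum fun s _ => mul_le_mul_of_nonneg_right (NeedleBondMarginal.sum_bond_abs_qJet_le n μ _ β s) (hg s)
    _ = _ := by rw [Finset.mul_sum]

/-- [folklore] **THE (1.22) SUM OF THE `ndl ⊗ proj` WORD AT ONE BASE SITE, FROM ABSTRACT LETTERS**: under the letters of `abs_ndlProj_word_le` (`δ > 0`,
the needle profile damped at rate `ε₀∕n`), for every base site `b`:
`|fullSum (w ↦ w_μw_ν·word(b,w))| ≤ (½e^{δ})·(n²·((1+4∕δ)²·(m₀·K₄(δ∕2))))`, `m₀ := ((n−1)n⁻⁴)·((K₅+K₆)·KGC·n⁴ + (K₃+K₄)·KΦ·cR₁(ε₀)·n³)`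
(gan24-leaf-05's block-decay × mass junction `NeedleGhostBubble2Row.abs_fullSum_weight_le_of_blockDecay_mass`, the mass being §2's bond-marginal block mass). -/
theorem abs_fullSum_ndlProj_le (ha : 0 < a) (hA : Spr (Ga n a)) {cQ KGC KΦ K₃ K₄ K₅ K₆ δ ε₀ : ℝ}
    (hKGC : 0 ≤ KGC) (hKΦ : 0 ≤ KΦ) (hK₃ : 0 ≤ K₃) (hK₄ : 0 ≤ K₄) (hK₅ : 0 ≤ K₅) (hK₆ : 0 ≤ K₆) (hδ : 0 < δ) (hε₀ : 0 < ε₀)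
    (hGC : ∀ (u x : Pt) (α : Fin 4), |applyK (Ga n a)
        (grad (fun q => cQ * (∑ z ∈ B (n - 1) (blk (n - 1) u), Pgt n a z q () ()) - kerP (d := 4) (n - 1) a q (blk (n - 1) u))) x α|
      ≤ KGC * Real.exp (-(δ * dist (blk (n - 1) x) (blk (n - 1) u))))
    (hΦ : ∀ (κ : Fin 4) (u x : Pt) (α : Fin 4), |applyK (Ga n a) (grad (ndlRow n a κ u)) x α|
      ≤ KΦ * ∑ s ∈ B (n - 1) (blk (n - 1) u), |qJet n κ u (blk (n - 1) u) s|
          * (Real.exp (-(ε₀ / n) * PoissonInterior.supNorm (d := 4) (x - s)) / nrm (x - s) ^ 1))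
    (h₃ : ∀ (u q : Pt), |pairing (grad (fun q' => cQ * (∑ z ∈ B (n - 1) (blk (n - 1) u), Pgt n a z q' () ()) - kerP (d := 4) (n - 1) a q' (blk (n - 1) u)))
        (applyK (Ga n a) (colGrad (Pgt n a) q))| ≤ K₃ * Real.exp (-(δ * dist (blk (n - 1) q) (blk (n - 1) u))))
    (h₄ : ∀ (u p : Pt), |pairing (applyK (Ga n a)
        (grad (fun q' => cQ * (∑ z ∈ B (n - 1) (blk (n - 1) u), Pgt n a z q' () ()) - kerP (d := 4) (n - 1) a q' (blk (n - 1) u))))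
        (rowGrad (Pgt n a) p)| ≤ K₄ * Real.exp (-(δ * dist (blk (n - 1) p) (blk (n - 1) u))))
    (h₅ : ∀ (κ : Fin 4) (u q : Pt), |pairing (grad (ndlRow n a κ u)) (applyK (Ga n a) (colGrad (Pgt n a) q))|
      ≤ K₅ * ∑ s ∈ B (n - 1) (blk (n - 1) u), |qJet n κ u (blk (n - 1) u) s|)
    (h₆ : ∀ (κ : Fin 4) (u p : Pt), |pairing (applyK (Ga n a) (grad (ndlRow n a κ u))) (rowGrad (Pgt n a) p)|
      ≤ K₆ * ∑ s ∈ B (n - 1) (blk (n - 1) u), |qJet n κ u (blk (n - 1) u) s|)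
    (μ ν : Fin 4) (b : Pt) :
    |fullSum (fun w : Pt => toReal w μ * toReal w ν * biBubbleTable (Ga n a) (Ga n a) (ndlPiece n a cQ) (projPiece n a) μ ν (b + w) b)|
      ≤ (1 / 2 * Real.exp δ) * ((n : ℝ) ^ 2 * ((1 + 4 / δ) ^ 2 *
          ((((n : ℝ) - 1) * ((n : ℝ) ^ 4)⁻¹ * ((K₅ + K₆) * KGC * (n : ℝ) ^ 4 + (K₃ + K₄) * KΦ *
            (2 * (Nat.factorial 0) * (2 / ε₀) ^ 0 * (1 + 2 * (4 : ℕ) * 3 ^ (4 - 1) * ((Nat.factorial (4 - 1 - 1)) * (4 / ε₀) ^ (4 - 1 - 1) * (1 + 4 / ε₀)))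
              * (n : ℝ) ^ 3))) * latticeConst 4 (δ / 2)))) := by
  have hn : (0 : ℝ) < n := by exact_mod_cast Nat.pos_of_ne_zero (NeZero.ne n)
  have hn1 : (1 : ℝ) ≤ n := by exact_mod_cast NeZero.one_le
  set m : ℕ := n - 1 with hm
  set cR₁ : ℝ := 2 * (Nat.factorial 0) * (2 / ε₀) ^ 0 *
    (1 + 2 * (4 : ℕ) * 3 ^ (4 - 1) * ((Nat.factorial (4 - 1 - 1)) * (4 / ε₀) ^ (4 - 1 - 1) * (1 + 4 / ε₀))) with hcR₁
  set A₀ : ℝ := (K₅ + K₆) * KGC with hA₀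
  set B₀ : ℝ := (K₃ + K₄) * KΦ with hB₀
  have hA₀0 : 0 ≤ A₀ := by positivity
  have hB₀0 : 0 ≤ B₀ := by positivity
  have hprof0 : ∀ s : Pt, 0 ≤ Real.exp (-(ε₀ / n) * PoissonInterior.supNorm (d := 4) (b - s)) / nrm (b - s) ^ 1 := fun s =>
    div_nonneg (Real.exp_pos _).le (pow_nonneg (nrm_pos _).le 1)
  have hg0 : ∀ s : Pt, 0 ≤ A₀ + B₀ * (Real.exp (-(ε₀ / n) * PoissonInterior.supNorm (d := 4) (b - s)) / nrm (b - s) ^ 1) := fun s =>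
    add_nonneg hA₀0 (mul_nonneg hB₀0 (hprof0 s))
  set F : Pt → ℝ := fun u => ∑ s ∈ B m (blk m u), |qJet n μ u (blk m u) s| *
    (A₀ + B₀ * (Real.exp (-(ε₀ / n) * PoissonInterior.supNorm (d := 4) (b - s)) / nrm (b - s) ^ 1)) with hF
  have hF0 : ∀ u, 0 ≤ F u := fun u => Finset.sum_nonneg fun s _ => mul_nonneg (abs_nonneg _) (hg0 s)
  set m₀ : ℝ := ((n : ℝ) - 1) * ((n : ℝ) ^ 4)⁻¹ * (A₀ * (n : ℝ) ^ 4 + B₀ * (cR₁ * (n : ℝ) ^ 3)) with hm₀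
  have hmass : ∀ β' : Pt, ∑ u ∈ B m β', F u ≤ m₀ := by
    intro β'
    refine (sum_B_needle_mass_le μ β' hg0).trans ?_
    rw [hm₀]
    refine mul_le_mul_of_nonneg_left ?_ (mul_nonneg (sub_nonneg.2 hn1) (by positivity))
    rw [Finset.sum_add_distrib]
    refine add_le_add ?_ ?_
    · rw [Finset.sum_const, nsmul_eq_mul, card_B, cast_pred_add_one n, mul_comm]
    · rw [← Finset.mul_sum]
      exact mul_le_mul_of_nonneg_left (sum_B_prof_le (n := n) hε₀ b β') hB₀0
  have hfw : ∀ w : Pt, |biBubbleTable (Ga n a) (Ga n a) (ndlPiece n a cQ) (projPiece n a) μ ν (b + w) b|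
      ≤ (1 / 2 * Real.exp δ) * Real.exp (-(δ * dist (blk m (b + w)) (blk m b))) * F (b + w) := by
    intro w
    have h := abs_ndlProj_word_le n a ha hA hKGC hKΦ hK₃ hK₄ hK₅ hK₆ hδ.le hGC hΦ h₃ h₄ h₅ h₆ μ ν b w
    rw [dist_comm] at h
    exact h
  have h := abs_fullSum_weight_le_of_blockDecay_mass n (f := fun w : Pt => biBubbleTable (Ga n a) (Ga n a) (ndlPiece n a cQ) (projPiece n a) μ ν (b + w) b)
    (F := F) (M := 1 / 2 * Real.exp δ) (by positivity) hδ hF0 hmass b μ ν hfw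
  refine h.trans (le_of_eq ?_)
  rw [hm₀, hA₀, hB₀, hcR₁]

/-! ## §3 The cell: letters instantiated, n-powers cancelled, base average -/

variable {n}

/-- [folklore] **«GN-33 ∕ NP»: THE `ndlPiece ⊗ projPiece` CELL OF T₃ IS n-UNIFORM** — the hypothesis `hnp` of `GluonNeedleGlue.h₃_of_cells`, modulo
[B5, Prop. 1.2] ∧ [B5, (1.126)–(1.127)] BY NAME and a uniform bound `cQ₀` on the stencil weight `cQ n` (P13: `C = C(a, cQ₀)`): one `C ≥ 0` with
`|cellSum n a (ndlPiece n a (cQ n)) (projPiece n a) μ ν| ≤ C` for every `n ≥ 1`. -/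
theorem exists_ndlProj_row_le (ha : 0 < a) (h12 : B5.Prop12Printed (fam nOf hn1 MOf a ha)) (h126 : B5.Kernel126_127Printed (kfam nOf MOf))
    {cQ : ℕ → ℝ} {cQ₀ : ℝ} (hcQ : ∀ n, |cQ n| ≤ cQ₀) (μ ν : Fin 4) :
    ∃ C : ℝ, 0 ≤ C ∧ ∀ (n : ℕ) [NeZero n], |cellSum n a (ndlPiece n a (cQ n)) (projPiece n a) μ ν| ≤ C := by
  obtain ⟨kGC, δ₂, hδ₂, hkGC, hGC⟩ := exists_applyK_gradC_le a ha h12 h126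
  obtain ⟨kΦ, ε₀, hε₀, hkΦ, hΦ⟩ := exists_applyK_grad_row_le a ha h12 h126
  obtain ⟨k₃, δ₃, hδ₃, hk₃, h₃⟩ := exists_pairing_gradC_applyK_colGrad_le a ha h12 h126
  obtain ⟨k₄, δ₄, hδ₄, hk₄, h₄⟩ := exists_pairing_applyK_gradC_rowGrad_le a ha h12 h126
  obtain ⟨k₅, hk₅, h₅⟩ := exists_pairing_grad_row_applyK_colGrad_le a ha h12 h126
  obtain ⟨k₆, hk₆, h₆⟩ := exists_pairing_applyK_grad_row_rowGrad_le a ha h12 h126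
  have hcP := cPPs_nonneg 4 ha; have hcs := cPs_nonneg 4 ha
  have hcQ₀ : 0 ≤ cQ₀ := (abs_nonneg _).trans (hcQ 0)
  set δm : ℝ := min δ₂ (min δ₃ δ₄) with hδm
  have hδm0 : 0 < δm := lt_min hδ₂ (lt_min hδ₃ hδ₄)
  have hm2 : δm ≤ δ₂ := min_le_left _ _
  have hm3 : δm ≤ δ₃ := (min_le_right _ _).trans (min_le_left _ _)
  have hm4 : δm ≤ δ₄ := (min_le_right _ _).trans (min_le_right _ _)
  set C₁ : ℝ := cQ₀ * cPPs 4 a + cPs 4 a with hC₁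
  have hC₁0 : 0 ≤ C₁ := by positivity
  set cR₁ : ℝ := 2 * (Nat.factorial 0) * (2 / ε₀) ^ 0 *
    (1 + 2 * (4 : ℕ) * 3 ^ (4 - 1) * ((Nat.factorial (4 - 1 - 1)) * (4 / ε₀) ^ (4 - 1 - 1) * (1 + 4 / ε₀))) with hcR₁
  have hcR₁0 : 0 ≤ cR₁ := by positivity
  set Q : ℝ := C₁ * ((k₅ + k₆) * kGC + (k₃ + k₄) * kΦ * cR₁) with hQ
  have hQ0 : 0 ≤ Q := by positivity
  set C : ℝ := (1 / 2 * Real.exp δm) * ((1 + 4 / δm) ^ 2 * (Q * latticeConst 4 (δm / 2))) with hC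
  have hK := latticeConst_nonneg 4 (half_pos hδm0).le
  refine ⟨C, by positivity, fun n _ => ?_⟩
  have hn : (0 : ℝ) < n := by exact_mod_cast Nat.pos_of_ne_zero (NeZero.ne n)
  have hn1 : (1 : ℝ) ≤ n := by exact_mod_cast NeZero.one_le
  have hA : Spr (Ga n a) := spr_Ga_of_prop12 (a := a) (ha := ha) h12 h126 n
  -- the column prefactor at this `n`, weakened to `cQ₀`
  have hC₀ : |cQ n| * cPPs 4 a + cPs 4 a ≤ C₁ := by rw [hC₁]; exact add_le_add (mul_le_mul_of_nonneg_right (hcQ n) hcP) le_rfl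
  have hexpm : ∀ {δ' : ℝ} (_ : δm ≤ δ') (t : ℝ), 0 ≤ t → Real.exp (-(δ' * t)) ≤ Real.exp (-(δm * t)) := fun hle t ht =>
    Real.exp_le_exp.2 (neg_le_neg (mul_le_mul_of_nonneg_right hle ht))
  -- the letters at this `n`, weakened to the common rate `δm` and the common prefactor `C₁`
  have hGCn : ∀ (u x : Pt) (α : Fin 4), |applyK (Ga n a) (grad (fun q => cQ n * (∑ z ∈ B (n - 1) (blk (n - 1) u), Pgt n a z q () ())
      - kerP (d := 4) (n - 1) a q (blk (n - 1) u))) x α| ≤ C₁ * kGC * (n : ℝ) * Real.exp (-(δm * dist (blk (n - 1) x) (blk (n - 1) u))) :=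
    fun u x α => (hGC n (cQ n) u x α).trans (by
      rw [mul_comm kGC (|cQ n| * cPPs 4 a + cPs 4 a)]
      exact mul_le_mul (mul_le_mul_of_nonneg_right (mul_le_mul_of_nonneg_right hC₀ hkGC) hn.le)
        (hexpm hm2 _ dist_nonneg) (Real.exp_pos _).le (by positivity))
  have h₃n : ∀ (u q : Pt), |pairing (grad (fun q' => cQ n * (∑ z ∈ B (n - 1) (blk (n - 1) u), Pgt n a z q' () ())
      - kerP (d := 4) (n - 1) a q' (blk (n - 1) u))) (applyK (Ga n a) (colGrad (Pgt n a) q))|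
      ≤ C₁ * k₃ * Real.exp (-(δm * dist (blk (n - 1) q) (blk (n - 1) u))) :=
    fun u q => (h₃ n (cQ n) u q).trans (by
      rw [mul_comm k₃ (|cQ n| * cPPs 4 a + cPs 4 a), dist_comm (blk (n - 1) u) (blk (n - 1) q)]
      exact mul_le_mul (mul_le_mul_of_nonneg_right hC₀ hk₃) (hexpm hm3 _ dist_nonneg) (Real.exp_pos _).le (by positivity))
  have h₄n : ∀ (u p : Pt), |pairing (applyK (Ga n a) (grad (fun q' => cQ n * (∑ z ∈ B (n - 1) (blk (n - 1) u), Pgt n a z q' () ())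
      - kerP (d := 4) (n - 1) a q' (blk (n - 1) u)))) (rowGrad (Pgt n a) p)|
      ≤ C₁ * k₄ * Real.exp (-(δm * dist (blk (n - 1) p) (blk (n - 1) u))) :=
    fun u p => (h₄ n (cQ n) u p).trans (by
      rw [mul_comm k₄ (|cQ n| * cPPs 4 a + cPs 4 a), dist_comm (blk (n - 1) u) (blk (n - 1) p)]
      exact mul_le_mul (mul_le_mul_of_nonneg_right hC₀ hk₄) (hexpm hm4 _ dist_nonneg) (Real.exp_pos _).le (by positivity))
  -- the mass at scale n: `n²·m₀ ≤ Q`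
  have hQn : (n : ℝ) ^ 2 * (((n : ℝ) - 1) * ((n : ℝ) ^ 4)⁻¹ * ((k₅ / (n : ℝ) ^ 4 + k₆ / (n : ℝ) ^ 4) * (C₁ * kGC * (n : ℝ)) * (n : ℝ) ^ 4
      + (C₁ * k₃ + C₁ * k₄) * (kΦ / (n : ℝ) ^ 2) * (cR₁ * (n : ℝ) ^ 3))) ≤ Q := by
    have e : (n : ℝ) ^ 2 * (((n : ℝ) - 1) * ((n : ℝ) ^ 4)⁻¹ * ((k₅ / (n : ℝ) ^ 4 + k₆ / (n : ℝ) ^ 4) * (C₁ * kGC * (n : ℝ)) * (n : ℝ) ^ 4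
        + (C₁ * k₃ + C₁ * k₄) * (kΦ / (n : ℝ) ^ 2) * (cR₁ * (n : ℝ) ^ 3))) = (((n : ℝ) - 1) / (n : ℝ)) * Q := by
      rw [hQ]; field_simp
    rw [e]
    have h1 : ((n : ℝ) - 1) / (n : ℝ) ≤ 1 := (div_le_one hn).2 (sub_le_self _ zero_le_one)
    calc ((n : ℝ) - 1) / (n : ℝ) * Q ≤ 1 * Q := mul_le_mul_of_nonneg_right h1 hQ0
      _ = Q := one_mul Q
  -- one base site
  have hsite : ∀ b : Pt, |fullSum (fun w : Pt => toReal w μ * toReal w ν *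
      biBubbleTable (Ga n a) (Ga n a) (ndlPiece n a (cQ n)) (projPiece n a) μ ν (b + w) b)| ≤ C := by
    intro b
    have h := abs_fullSum_ndlProj_le n a ha hA (KGC := C₁ * kGC * (n : ℝ)) (KΦ := kΦ / (n : ℝ) ^ 2) (K₃ := C₁ * k₃) (K₄ := C₁ * k₄)
      (K₅ := k₅ / (n : ℝ) ^ 4) (K₆ := k₆ / (n : ℝ) ^ 4) (by positivity) (by positivity) (by positivity) (by positivity) (by positivity)
      (by positivity) hδm0 hε₀ hGCn (hΦ n) h₃n h₄n (h₅ n) (h₆ n) μ ν b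
    refine h.trans ?_
    have hfac : 0 ≤ (1 / 2 * Real.exp δm) * ((1 + 4 / δm) ^ 2 * latticeConst 4 (δm / 2)) := by positivity
    calc (1 / 2 * Real.exp δm) * ((n : ℝ) ^ 2 * ((1 + 4 / δm) ^ 2 *
          ((((n : ℝ) - 1) * ((n : ℝ) ^ 4)⁻¹ * ((k₅ / (n : ℝ) ^ 4 + k₆ / (n : ℝ) ^ 4) * (C₁ * kGC * (n : ℝ)) * (n : ℝ) ^ 4
            + (C₁ * k₃ + C₁ * k₄) * (kΦ / (n : ℝ) ^ 2) * (cR₁ * (n : ℝ) ^ 3))) * latticeConst 4 (δm / 2))))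
        = (1 / 2 * Real.exp δm) * ((1 + 4 / δm) ^ 2 * latticeConst 4 (δm / 2)) * ((n : ℝ) ^ 2 *
          (((n : ℝ) - 1) * ((n : ℝ) ^ 4)⁻¹ * ((k₅ / (n : ℝ) ^ 4 + k₆ / (n : ℝ) ^ 4) * (C₁ * kGC * (n : ℝ)) * (n : ℝ) ^ 4
            + (C₁ * k₃ + C₁ * k₄) * (kΦ / (n : ℝ) ^ 2) * (cR₁ * (n : ℝ) ^ 3)))) := by ring
      _ ≤ (1 / 2 * Real.exp δm) * ((1 + 4 / δm) ^ 2 * latticeConst 4 (δm / 2)) * Q := mul_le_mul_of_nonneg_left hQn hfac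
      _ = C := by rw [hC]; ring
  -- the base average is convex
  have hC0 : 0 ≤ C := by positivity
  rw [cellSum_def]
  refine (Finset.abs_sum_le_sum_abs _ _).trans ?_
  calc ∑ b ∈ (univ : Finset (Fin 4 → Fin n)).image resSite, |((n : ℝ) ^ 4)⁻¹ *
        fullSum (fun w : Pt => toReal w μ * toReal w ν * biBubbleTable (Ga n a) (Ga n a) (ndlPiece n a (cQ n)) (projPiece n a) μ ν (b + w) b)|
      ≤ ∑ _b ∈ (univ : Finset (Fin 4 → Fin n)).image resSite, ((n : ℝ) ^ 4)⁻¹ * C := by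
        refine Finset.sum_le_sum fun b _ => ?_
        rw [abs_mul, abs_of_nonneg (by positivity : (0 : ℝ) ≤ ((n : ℝ) ^ 4)⁻¹)]
        exact mul_le_mul_of_nonneg_left (hsite b) (by positivity)
    _ ≤ C := sum_resSite_avg_le hC0


end Summit.QuantumFields.BalabanUV.Beta.D1BFx.NeedleNdlProjRow

end
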